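import Mathlib.Analysis.InnerProductSpace.Basic
import Mathlib.Topology.Algebra.Module.FiniteDimension
import Mathlib.Analysis.Normed.Operator.Basic
import Mathlib.Data.Fintype.Vector
import HarnessLib

/-!
# Nelson's sum-of-squares estimate: `Δ`-finite vectors have factorially bounded words

Let `H` be a complex inner product space, `(A_i)_{i ∈ ι}` a finite family of linear operators on
`H` which are skew-symmetric (`⟪A_i u, w⟫ = -⟪u, A_i w⟫`) and close under commutators
(`A_i A_m - A_m A_i = ∑_l c_{iml} A_l` with real structure constants), and let
`Δ = ∑_i A_i²` ("Nelson's Laplacian"). If `T ≤ H` is a finite-dimensional subspace with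
`Δ T ⊆ T`, then every word `A_α = A_{α₁} ⋯ A_{αₙ}` satisfies

  `‖A_α w‖ ≤ M ^ n * n ! * ‖w‖`  for all `w ∈ T`,

with `M = √B + 2 d² c`, where `‖Δ w‖ ≤ B ‖w‖` on `T`, `d = |ι|` and `|c_{iml}| ≤ c`
(`norm_wordOp_le_of_laplacian_stable`); consequently for `A_X = ∑ x_i A_i` (`x_i ∈ ℝ`),
`‖A_X ^ n w‖ ≤ (M ∑ |x_i|) ^ n * n ! * ‖w‖` (`norm_pow_sum_smul_le_of_laplacian_stable`). This is
the special case "`v` is `Δ`-finite" of Nelson's theorem that analytic vectors of `Δ` are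
analytic vectors for the whole Lie algebra of operators (Nelson 1959; Goodman 1969), in which
the combinatorics collapses to the one-line recursion
`x² ≤ B Rₙ² + 2 n d² c Rₙ x` for `x = max_{|β| = n+1} ‖A_β w‖ / ‖w‖`: indeed
`‖A_j A_α w‖² ≤ ∑_i ‖A_i A_α w‖² = -Re ⟪A_α w, Δ A_α w⟫` (skew-symmetry),
`Δ A_α = A_α Δ + [Δ, A_α]`, and `[Δ, A_α]` is a sum of `2 n d²` words of length `n + 1` with
coefficients bounded by `c` (`norm_wordOp_commLaplacian_le`). It is the operator-theoretic core of
the analyticity of `K`-finite `Z(𝔤)`-finite vectors of unitary representations along one-parameter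
subgroups (Harish-Chandra 1953, Lemma 34), used in `Literature/NumberTheory/Automorphic`.

Everything here is proved (no named facts); the only definitions are the word operators `wordOp`,
the Laplacian `laplacian`, the commutator `commLaplacian` and the recursive bound `wordBound`.

## References

* E. Nelson, *Analytic vectors*, Ann. of Math. 70 (1959), 572–615 [Nelson1959] (not held; the
  theorem "an analytic vector for `Δ` is an analytic vector for the representation", of which the
  `Δ`-finite case proved here is the elementary instance).
* R. Goodman, *Analytic and entire vectors for representations of Lie groups*, Trans. AMS 143
  (1969), 55–76 [Goodman1969] (not held).
* Harish-Chandra, *Representations of a semisimple Lie group on a Banach space. I*, Trans. AMS 75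
  (1953), Lemma 34 (p. 228) [HarishChandraTAMS1953] (held).
-/

open scoped InnerProductSpace
open Finset

noncomputable section

namespace Literature.Analysis.OperatorTheory

variable {H : Type*} [NormedAddCommGroup H] [InnerProductSpace ℂ H] {ι : Type*}

/-! ## Word operators and the Laplacian -/

/-- The word operator `A_α = A_{α₁} ∘ ⋯ ∘ A_{αₙ}` of a list `α = [α₁, …, αₙ]` (the empty word acts
as the identity). Nelson 1959. [folklore] -/
def wordOp (A : ι → Module.End ℂ H) (α : List ι) : Module.End ℂ H :=
  (α.map A).prod

/-- `A_{[]} = 1`. [folklore] -/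
@[simp] theorem wordOp_nil (A : ι → Module.End ℂ H) : wordOp A [] = 1 := by
  simp [wordOp]

/-- `A_{i :: α} = A_i ∘ A_α`. [folklore] -/
@[simp]
theorem wordOp_cons (A : ι → Module.End ℂ H) (i : ι) (α : List ι) :
    wordOp A (i :: α) = A i * wordOp A α := by
  simp [wordOp]

/-- `A_{α ++ β} = A_α ∘ A_β`. [folklore] -/
theorem wordOp_append (A : ι → Module.End ℂ H) (α β : List ι) :
    wordOp A (α ++ β) = wordOp A α * wordOp A β := by
  simp [wordOp, List.map_append, List.prod_append]

/-- `A_{[i]} = A_i`. [folklore] -/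
@[simp] theorem wordOp_singleton (A : ι → Module.End ℂ H) (i : ι) : wordOp A [i] = A i := by
  simp [wordOp]

variable [Fintype ι]

/-- Nelson's Laplacian `Δ = ∑_i A_i²` of the family `A`. Nelson 1959. [folklore] -/
def laplacian (A : ι → Module.End ℂ H) : Module.End ℂ H :=
  ∑ i, A i * A i

/-- `Δ u = ∑_i A_i (A_i u)`. [folklore] -/
theorem laplacian_apply (A : ι → Module.End ℂ H) (u : H) :
    laplacian A u = ∑ i, A i (A i u) := by
  simp [laplacian, LinearMap.sum_apply]

/-! ## Skew-symmetry: `∑_i ‖A_i u‖² = -Re ⟪u, Δ u⟫` -/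

/-- For a skew-symmetric family, `‖A_j u‖ ^ 2 ≤ -Re ⟪u, Δ u⟫` for every `j`
(`∑_i ‖A_i u‖² = ∑_i ⟪A_i u, A_i u⟫ = -∑_i ⟪u, A_i A_i u⟫`). Nelson 1959 (the inequality
`‖X ξ‖² ≤ (-Δ ξ, ξ)`). [folklore] -/
theorem norm_apply_sq_le_neg_re_inner_laplacian (A : ι → Module.End ℂ H)
    (hskew : ∀ i u w, ⟪A i u, w⟫_ℂ = -⟪u, A i w⟫_ℂ) (j : ι) (u : H) :
    ‖A j u‖ ^ 2 ≤ -RCLike.re ⟪u, laplacian A u⟫_ℂ := by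
  have hsum : -RCLike.re ⟪u, laplacian A u⟫_ℂ = ∑ i, ‖A i u‖ ^ 2 := by
    rw [laplacian_apply, inner_sum, map_sum, ← Finset.sum_neg_distrib]
    refine Finset.sum_congr rfl fun i _ ↦ ?_
    rw [← inner_self_eq_norm_sq (𝕜 := ℂ), hskew i u (A i u)]
    simp
  rw [hsum]
  exact Finset.single_le_sum (f := fun i ↦ ‖A i u‖ ^ 2) (fun i _ ↦ sq_nonneg _) (mem_univ j)

/-! ## The commutator `[Δ, A_α]` as a sum of `2 |α| d²` words of length `|α| + 1` -/

/-- The commutator `[Δ, A_α] = Δ A_α - A_α Δ`. [folklore] -/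
def commLaplacian (A : ι → Module.End ℂ H) (α : List ι) : Module.End ℂ H :=
  laplacian A * wordOp A α - wordOp A α * laplacian A

/-- `[Δ, A_j] = ∑_i ∑_m c_{ijm} (A_i A_m + A_m A_i)` when `A_i A_j - A_j A_i = ∑_m c_{ijm} A_m`.
Nelson 1959 (`ad X (Δ)`). [folklore] -/
theorem commLaplacian_singleton (A : ι → Module.End ℂ H) (c : ι → ι → ι → ℝ)
    (hbr : ∀ i m, A i * A m - A m * A i = ∑ l, (c i m l : ℂ) • A l) (j : ι) :
    commLaplacian A [j] = ∑ i, ∑ m, (c i j m : ℂ) • (A i * A m + A m * A i) := by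
  have key : ∀ i, A i * A i * A j - A j * (A i * A i) =
      A i * (A i * A j - A j * A i) + (A i * A j - A j * A i) * A i := fun i ↦ by
    noncomm_ring
  simp only [commLaplacian, wordOp_singleton, laplacian, Finset.sum_mul, Finset.mul_sum,
    ← Finset.sum_sub_distrib, key, hbr, smul_add, Finset.sum_add_distrib, mul_smul_comm,
    smul_mul_assoc]

/-- The recursion `[Δ, A_{j :: α}] = [Δ, A_j] A_α + A_j [Δ, A_α]`. [folklore] -/
theorem commLaplacian_cons (A : ι → Module.End ℂ H) (j : ι) (α : List ι) :
    commLaplacian A (j :: α) = commLaplacian A [j] * wordOp A α + A j * commLaplacian A α := by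
  simp only [commLaplacian, wordOp_cons, wordOp_nil, mul_one]
  noncomm_ring

/-- **The commutator estimate.** If every word `β` of length `|α| + 1` satisfies
`‖A_p (A_β w)‖ ≤ x` for the fixed prefix `p`, then `‖A_p ([Δ, A_α] w)‖ ≤ 2 |α| d² c x`, where
`d = |ι|` and `|c_{iml}| ≤ c`: `[Δ, A_α]` is a sum of `2 |α| d²` words of length `|α| + 1` with
coefficients bounded by `c`. Nelson 1959 (estimates of `(ad X)ⁿ Δ`). [folklore] -/
theorem norm_wordOp_commLaplacian_le (A : ι → Module.End ℂ H) (c : ι → ι → ι → ℝ)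
    (hbr : ∀ i m, A i * A m - A m * A i = ∑ l, (c i m l : ℂ) • A l) {cM : ℝ}
    (hc : ∀ i m l, |c i m l| ≤ cM) (α p : List ι) (w : H) {x : ℝ}
    (hx : ∀ β : List ι, β.length = α.length + 1 → ‖wordOp A (p ++ β) w‖ ≤ x) :
    ‖wordOp A p (commLaplacian A α w)‖ ≤ 2 * α.length * (Fintype.card ι) ^ 2 * cM * x := by
  induction α generalizing p with
  | nil =>
    have h0 : commLaplacian A [] = 0 := by simp [commLaplacian]
    simp [h0]
  | cons j α ih =>
    have hcM : 0 ≤ cM := (abs_nonneg _).trans (hc j j j)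
    -- the two pieces of the recursion
    rw [commLaplacian_cons, LinearMap.add_apply, map_add, Module.End.mul_apply, Module.End.mul_apply]
    refine (norm_add_le _ _).trans ?_
    -- first piece: `A_p ([Δ, A_j] (A_α w))`, `2 d²` words of length `|α| + 2`
    have h1 : ‖wordOp A p (commLaplacian A [j] (wordOp A α w))‖ ≤
        2 * (Fintype.card ι) ^ 2 * cM * x := by
      rw [commLaplacian_singleton A c hbr j]
      simp only [LinearMap.sum_apply, LinearMap.smul_apply, LinearMap.add_apply,
        Module.End.mul_apply, map_sum, map_smul, map_add]
      calc ‖∑ i, ∑ m, (c i j m : ℂ) • (wordOp A p (A i (A m (wordOp A α w))) +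
              wordOp A p (A m (A i (wordOp A α w))))‖
          ≤ ∑ i, ∑ m, ‖(c i j m : ℂ) • (wordOp A p (A i (A m (wordOp A α w))) +
              wordOp A p (A m (A i (wordOp A α w))))‖ :=
            (norm_sum_le _ _).trans (Finset.sum_le_sum fun i _ ↦ norm_sum_le _ _)
        _ ≤ ∑ _i : ι, ∑ _m : ι, cM * (x + x) := by
            refine Finset.sum_le_sum fun i _ ↦ Finset.sum_le_sum fun m _ ↦ ?_
            rw [norm_smul]
            refine mul_le_mul ?_ ((norm_add_le _ _).trans (add_le_add ?_ ?_)) (norm_nonneg _) hcM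
            · rw [Complex.norm_real, Real.norm_eq_abs]
              exact hc i j m
            · have := hx (i :: m :: α) (by simp)
              rwa [wordOp_append, wordOp_cons, wordOp_cons, Module.End.mul_apply,
                Module.End.mul_apply, Module.End.mul_apply] at this
            · have := hx (m :: i :: α) (by simp)
              rwa [wordOp_append, wordOp_cons, wordOp_cons, Module.End.mul_apply,
                Module.End.mul_apply, Module.End.mul_apply] at this
        _ = 2 * (Fintype.card ι) ^ 2 * cM * x := by
            simp only [Finset.sum_const, Finset.card_univ]
            ring
    -- second piece: `A_{p ++ [j]} ([Δ, A_α] w)`, by induction with the longer prefix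
    have h2 : ‖wordOp A p (A j (commLaplacian A α w))‖ ≤
        2 * α.length * (Fintype.card ι) ^ 2 * cM * x := by
      have := ih (p ++ [j]) fun β hβ ↦ by
        have h := hx (j :: β) (by simp [hβ])
        rwa [show p ++ j :: β = p ++ [j] ++ β by simp] at h
      rwa [wordOp_append, wordOp_singleton, Module.End.mul_apply] at this
    refine (add_le_add h1 h2).trans (le_of_eq ?_)
    simp only [List.length_cons, Nat.cast_add, Nat.cast_one]
    ring

/-! ## The recursion and the factorial bound -/

/-- The elementary inequality behind the recursion: `x² ≤ B a² + b a x` with `x, a, B, b ≥ 0`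
forces `x ≤ (√B + b) a`. [folklore] -/
theorem le_of_sq_le_add_mul {x a B b : ℝ} (ha : 0 ≤ a) (hB : 0 ≤ B) (hb : 0 ≤ b)
    (h : x ^ 2 ≤ B * a ^ 2 + b * a * x) : x ≤ (Real.sqrt B + b) * a := by
  refine le_of_not_gt fun hlt ↦ ?_
  have hs := Real.sq_sqrt hB
  have hsa : Real.sqrt B * a ≤ x := by
    have : Real.sqrt B * a ≤ (Real.sqrt B + b) * a := by nlinarith [Real.sqrt_nonneg B]
    exact this.trans hlt.le
  nlinarith [Real.sqrt_nonneg B, mul_nonneg (Real.sqrt_nonneg B) ha, mul_nonneg hb ha]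

/-- The Laplacian is bounded on a finite-dimensional subspace: `‖Δ w‖ ≤ B ‖w‖` for `w ∈ T`
(any linear map out of a finite-dimensional normed space is continuous). [folklore] -/
theorem exists_norm_laplacian_le (A : ι → Module.End ℂ H) (T : Submodule ℂ H)
    [FiniteDimensional ℂ T] : ∃ B : ℝ, 0 ≤ B ∧ ∀ w ∈ T, ‖laplacian A w‖ ≤ B * ‖w‖ := by
  let L : T →L[ℂ] H := LinearMap.toContinuousLinearMap ((laplacian A).domRestrict T)
  refine ⟨‖L‖, norm_nonneg L, fun w hw ↦ ?_⟩
  have h := L.le_opNorm ⟨w, hw⟩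
  simpa [L] using h

/-- The recursively defined bounds `R₀ = 1`, `R_{n+1} = (√B + 2 n d² c) Rₙ`. [folklore] -/
def wordBound (B cM : ℝ) (d : ℕ) : ℕ → ℝ
  | 0 => 1
  | n + 1 => (Real.sqrt B + 2 * n * (d : ℝ) ^ 2 * cM) * wordBound B cM d n

/-- `0 ≤ Rₙ`. [folklore] -/
theorem wordBound_nonneg {B cM : ℝ} (hcM : 0 ≤ cM) (d n : ℕ) : 0 ≤ wordBound B cM d n := by
  induction n with
  | zero => simp [wordBound]
  | succ n ih =>
    simp only [wordBound]
    exact mul_nonneg (by positivity) ih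

/-- `Rₙ ≤ (√B + 2 d² c) ^ n * n !`. [folklore] -/
theorem wordBound_le_pow_mul_factorial {B cM : ℝ} (hcM : 0 ≤ cM) (d n : ℕ) :
    wordBound B cM d n ≤ (Real.sqrt B + 2 * (d : ℝ) ^ 2 * cM) ^ n * n.factorial := by
  induction n with
  | zero => simp [wordBound]
  | succ n ih =>
    simp only [wordBound, pow_succ, Nat.factorial_succ, Nat.cast_mul, Nat.cast_add, Nat.cast_one]
    have h1 : Real.sqrt B + 2 * n * (d : ℝ) ^ 2 * cM ≤
        (Real.sqrt B + 2 * (d : ℝ) ^ 2 * cM) * (n + 1) := by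
      nlinarith [Real.sqrt_nonneg B, mul_nonneg (mul_nonneg (by positivity : (0 : ℝ) ≤ 2 * (d : ℝ) ^ 2) hcM)
        (Nat.cast_nonneg n)]
    calc (Real.sqrt B + 2 * n * (d : ℝ) ^ 2 * cM) * wordBound B cM d n
        ≤ ((Real.sqrt B + 2 * (d : ℝ) ^ 2 * cM) * (n + 1)) *
            ((Real.sqrt B + 2 * (d : ℝ) ^ 2 * cM) ^ n * n.factorial) :=
          mul_le_mul h1 ih (wordBound_nonneg hcM d n) (by positivity)
      _ = (Real.sqrt B + 2 * (d : ℝ) ^ 2 * cM) ^ n * (Real.sqrt B + 2 * (d : ℝ) ^ 2 * cM) *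
            ((n + 1) * n.factorial) := by ring

/-- **The recursion** (Nelson 1959, in the `Δ`-finite case): if `‖A_α w‖ ≤ Rₙ ‖w‖` for all
words of length `n` and all `w ∈ T`, where `Δ T ⊆ T` and `‖Δ w‖ ≤ B ‖w‖` on `T`, then
`‖A_β w‖ ≤ (√B + 2 n d² c) Rₙ ‖w‖` for all words `β` of length `n + 1` and `w ∈ T`. [folklore] -/
theorem norm_wordOp_succ_le (A : ι → Module.End ℂ H)
    (hskew : ∀ i u w, ⟪A i u, w⟫_ℂ = -⟪u, A i w⟫_ℂ) (c : ι → ι → ι → ℝ)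
    (hbr : ∀ i m, A i * A m - A m * A i = ∑ l, (c i m l : ℂ) • A l) {cM : ℝ}
    (hc : ∀ i m l, |c i m l| ≤ cM) {T : Submodule ℂ H}
    (hT : ∀ w ∈ T, laplacian A w ∈ T) {B : ℝ} (hB0 : 0 ≤ B)
    (hB : ∀ w ∈ T, ‖laplacian A w‖ ≤ B * ‖w‖) {n : ℕ} {R : ℝ} (hR0 : 0 ≤ R)
    (hR : ∀ (α : List ι), α.length = n → ∀ w ∈ T, ‖wordOp A α w‖ ≤ R * ‖w‖)
    (β : List ι) (hβ : β.length = n + 1) {w : H} (hw : w ∈ T) :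
    ‖wordOp A β w‖ ≤ (Real.sqrt B + 2 * n * (Fintype.card ι) ^ 2 * cM) * R * ‖w‖ := by
  classical
  have hcM : 0 ≤ cM := by
    obtain ⟨j, -⟩ := List.exists_mem_of_length_eq_add_one hβ
    exact (abs_nonneg _).trans (hc j j j)
  -- the maximal word of length `n + 1` at `w`
  obtain ⟨v₀, -, hv₀⟩ := Finset.exists_max_image (Finset.univ : Finset (List.Vector ι (n + 1)))
    (fun v ↦ ‖wordOp A v.1 w‖) ⟨⟨β, hβ⟩, Finset.mem_univ _⟩
  set x := ‖wordOp A v₀.1 w‖ with hx_def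
  have hxβ : ∀ γ : List ι, γ.length = n + 1 → ‖wordOp A γ w‖ ≤ x := fun γ hγ ↦
    hv₀ ⟨γ, hγ⟩ (Finset.mem_univ _)
  have hx0 : 0 ≤ x := norm_nonneg _
  -- `v₀ = j :: α` with `|α| = n`
  obtain ⟨j, α, hjα⟩ : ∃ j α, v₀.1 = j :: α := by
    match h : v₀.1 with
    | [] => exact absurd (h ▸ v₀.2) (by simp)
    | j :: α => exact ⟨j, α, rfl⟩
  have hα : α.length = n := by
    have := v₀.2
    rw [hjα, List.length_cons] at this
    omega
  -- the key inequality `x² ≤ B R² ‖w‖² + 2 n d² c R ‖w‖ x`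
  have hu : ‖wordOp A α w‖ ≤ R * ‖w‖ := hR α hα w hw
  have hxj : x = ‖A j (wordOp A α w)‖ := by
    rw [hx_def, hjα, wordOp_cons, Module.End.mul_apply]
  have hkey : x ^ 2 ≤ B * (R * ‖w‖) ^ 2 + (2 * n * (Fintype.card ι) ^ 2 * cM) * (R * ‖w‖) * x := by
    have h1 := norm_apply_sq_le_neg_re_inner_laplacian A hskew j (wordOp A α w)
    rw [← hxj] at h1
    refine h1.trans ?_
    -- `Δ A_α w = A_α (Δ w) + [Δ, A_α] w`
    have hsplit : laplacian A (wordOp A α w) =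
        wordOp A α (laplacian A w) + commLaplacian A α w := by
      simp [commLaplacian]
    rw [hsplit, inner_add_right, map_add, neg_add]
    refine add_le_add ?_ ?_
    · -- `-Re ⟪A_α w, A_α Δ w⟫ ≤ ‖A_α w‖ ‖A_α (Δ w)‖ ≤ (R‖w‖)(R B ‖w‖)`
      have hΔ : ‖wordOp A α (laplacian A w)‖ ≤ R * (B * ‖w‖) :=
        (hR α hα _ (hT w hw)).trans (mul_le_mul_of_nonneg_left (hB w hw) hR0)
      calc -RCLike.re ⟪wordOp A α w, wordOp A α (laplacian A w)⟫_ℂ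
          ≤ ‖⟪wordOp A α w, wordOp A α (laplacian A w)⟫_ℂ‖ := by
            refine (neg_le_abs _).trans ?_
            exact (RCLike.abs_re_le_norm _)
        _ ≤ ‖wordOp A α w‖ * ‖wordOp A α (laplacian A w)‖ := norm_inner_le_norm _ _
        _ ≤ (R * ‖w‖) * (R * (B * ‖w‖)) :=
            mul_le_mul hu hΔ (norm_nonneg _) (mul_nonneg hR0 (norm_nonneg _))
        _ = B * (R * ‖w‖) ^ 2 := by ring
    · -- `-Re ⟪A_α w, [Δ, A_α] w⟫ ≤ ‖A_α w‖ ‖[Δ, A_α] w‖ ≤ (R‖w‖)(2 n d² c x)`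
      have hcomm : ‖commLaplacian A α w‖ ≤ 2 * α.length * (Fintype.card ι) ^ 2 * cM * x := by
        have := norm_wordOp_commLaplacian_le A c hbr hc α [] w (x := x) fun γ hγ ↦
          hxβ γ (by rw [hγ, hα])
        simpa using this
      rw [hα] at hcomm
      calc -RCLike.re ⟪wordOp A α w, commLaplacian A α w⟫_ℂ
          ≤ ‖⟪wordOp A α w, commLaplacian A α w⟫_ℂ‖ :=
            (neg_le_abs _).trans (RCLike.abs_re_le_norm _)
        _ ≤ ‖wordOp A α w‖ * ‖commLaplacian A α w‖ := norm_inner_le_norm _ _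
        _ ≤ (R * ‖w‖) * (2 * n * (Fintype.card ι) ^ 2 * cM * x) :=
            mul_le_mul hu hcomm (norm_nonneg _) (mul_nonneg hR0 (norm_nonneg _))
        _ = (2 * n * (Fintype.card ι) ^ 2 * cM) * (R * ‖w‖) * x := by ring
  have hb : 0 ≤ 2 * (n : ℝ) * (Fintype.card ι) ^ 2 * cM := by positivity
  have := le_of_sq_le_add_mul (mul_nonneg hR0 (norm_nonneg _)) hB0 hb hkey
  calc ‖wordOp A β w‖ ≤ x := hxβ β hβ
    _ ≤ (Real.sqrt B + 2 * n * (Fintype.card ι) ^ 2 * cM) * (R * ‖w‖) := this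
    _ = _ := by ring

/-- **Nelson's estimate for `Δ`-finite vectors (factorial growth of words).** Let `(A_i)_{i ∈ ι}`
be a finite skew-symmetric family of operators on a complex inner product space, closed under
commutators with real structure constants bounded by `c`, `Δ = ∑ A_i²`, and `T` a
finite-dimensional subspace with `Δ T ⊆ T` and `‖Δ w‖ ≤ B ‖w‖` on `T`. Then for every word `α`
of length `n` and `w ∈ T`, `‖A_α w‖ ≤ (√B + 2 d² c) ^ n * n ! * ‖w‖`. Nelson 1959 (the case of
an eigenvector, or more generally a `Δ`-finite vector, of `Δ`, of the theorem that analytic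
vectors for `Δ` are analytic vectors for the representation); Goodman 1969. [folklore] -/
theorem norm_wordOp_le_of_laplacian_stable (A : ι → Module.End ℂ H)
    (hskew : ∀ i u w, ⟪A i u, w⟫_ℂ = -⟪u, A i w⟫_ℂ) (c : ι → ι → ι → ℝ)
    (hbr : ∀ i m, A i * A m - A m * A i = ∑ l, (c i m l : ℂ) • A l) {cM : ℝ} (hcM : 0 ≤ cM)
    (hc : ∀ i m l, |c i m l| ≤ cM) {T : Submodule ℂ H}
    (hT : ∀ w ∈ T, laplacian A w ∈ T) {B : ℝ} (hB0 : 0 ≤ B)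
    (hB : ∀ w ∈ T, ‖laplacian A w‖ ≤ B * ‖w‖)
    (α : List ι) {w : H} (hw : w ∈ T) :
    ‖wordOp A α w‖ ≤
      (Real.sqrt B + 2 * (Fintype.card ι : ℝ) ^ 2 * cM) ^ α.length * α.length.factorial * ‖w‖ := by
  -- `‖A_α w‖ ≤ R_{|α|} ‖w‖` by induction on the length
  have main : ∀ n (α : List ι), α.length = n → ∀ w ∈ T,
      ‖wordOp A α w‖ ≤ wordBound B cM (Fintype.card ι) n * ‖w‖ := by
    intro n
    induction n with
    | zero =>
      intro α hα w _
      rw [List.length_eq_zero_iff.mp hα]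
      simp [wordBound]
    | succ n ih =>
      intro β hβ w hw
      have := norm_wordOp_succ_le A hskew c hbr hc hT hB0 hB
        (wordBound_nonneg hcM _ n) ih β hβ hw
      simpa only [wordBound, mul_assoc] using this
  refine (main α.length α rfl w hw).trans ?_
  exact mul_le_mul_of_nonneg_right (wordBound_le_pow_mul_factorial hcM _ _) (norm_nonneg _)

/-- **Powers of a real combination `A_X = ∑ x_i A_i`.** Under the hypotheses of
`norm_wordOp_le_of_laplacian_stable`, for `x : ι → ℝ` and `w ∈ T`,
`‖A_X ^ m w‖ ≤ ((√B + 2 d² c) ∑ |x_i|) ^ m * m ! * ‖w‖`. (Expand one factor at a time: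
`A_X ^ {m+1} A_α = ∑_i x_i A_X ^ m A_{i :: α}`.) Nelson 1959 (the `Δ`-finite case). [folklore] -/
theorem norm_pow_sum_smul_le_of_laplacian_stable (A : ι → Module.End ℂ H)
    (hskew : ∀ i u w, ⟪A i u, w⟫_ℂ = -⟪u, A i w⟫_ℂ) (c : ι → ι → ι → ℝ)
    (hbr : ∀ i m, A i * A m - A m * A i = ∑ l, (c i m l : ℂ) • A l) {cM : ℝ} (hcM : 0 ≤ cM)
    (hc : ∀ i m l, |c i m l| ≤ cM) {T : Submodule ℂ H}
    (hT : ∀ w ∈ T, laplacian A w ∈ T) {B : ℝ} (hB0 : 0 ≤ B)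
    (hB : ∀ w ∈ T, ‖laplacian A w‖ ≤ B * ‖w‖)
    (x : ι → ℝ) (m : ℕ) {w : H} (hw : w ∈ T) :
    ‖((∑ i, (x i : ℂ) • A i) ^ m) w‖ ≤
      ((Real.sqrt B + 2 * (Fintype.card ι : ℝ) ^ 2 * cM) * ∑ i, |x i|) ^ m * m.factorial * ‖w‖ := by
  set M := Real.sqrt B + 2 * (Fintype.card ι : ℝ) ^ 2 * cM with hM
  set s := ∑ i, |x i| with hs
  have hM0 : 0 ≤ M := by positivity
  have hs0 : 0 ≤ s := Finset.sum_nonneg fun i _ ↦ abs_nonneg _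
  -- peel off one factor of `A_X` at a time, keeping a word on the right
  have peel : ∀ k (α : List ι),
      ‖((∑ i, (x i : ℂ) • A i) ^ k * wordOp A α) w‖ ≤
        s ^ k * (M ^ (k + α.length) * (k + α.length).factorial) * ‖w‖ := by
    intro k
    induction k with
    | zero =>
      intro α
      simpa using norm_wordOp_le_of_laplacian_stable A hskew c hbr hcM hc hT hB0 hB α hw
    | succ k ih =>
      intro α
      have hexp : (∑ i, (x i : ℂ) • A i) ^ (k + 1) * wordOp A α =
          ∑ i, (x i : ℂ) • ((∑ i, (x i : ℂ) • A i) ^ k * wordOp A (i :: α)) := by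
        rw [pow_succ, mul_assoc, Finset.sum_mul, Finset.mul_sum]
        refine Finset.sum_congr rfl fun i _ ↦ ?_
        rw [wordOp_cons, smul_mul_assoc, mul_smul_comm]
      rw [hexp, LinearMap.sum_apply]
      refine (norm_sum_le _ _).trans ?_
      calc ∑ i, ‖((x i : ℂ) • ((∑ i, (x i : ℂ) • A i) ^ k * wordOp A (i :: α))) w‖
          ≤ ∑ i, |x i| * (s ^ k * (M ^ (k + 1 + α.length) * (k + 1 + α.length).factorial) * ‖w‖) := by
            refine Finset.sum_le_sum fun i _ ↦ ?_
            rw [LinearMap.smul_apply, norm_smul, Complex.norm_real, Real.norm_eq_abs]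
            refine mul_le_mul_of_nonneg_left ?_ (abs_nonneg _)
            have := ih (i :: α)
            have e : k + (i :: α).length = k + 1 + α.length := by
              simp only [List.length_cons]; omega
            rwa [e] at this
        _ = s ^ (k + 1) * (M ^ (k + 1 + α.length) * (k + 1 + α.length).factorial) * ‖w‖ := by
            rw [← Finset.sum_mul, ← hs, pow_succ]
            ring
  have := peel m []
  simp only [wordOp_nil, mul_one, List.length_nil, add_zero] at this
  calc ‖((∑ i, (x i : ℂ) • A i) ^ m) w‖ ≤ s ^ m * (M ^ m * m.factorial) * ‖w‖ := this
    _ = (M * s) ^ m * m.factorial * ‖w‖ := by rw [mul_pow]; ring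

end Literature.Analysis.OperatorTheory
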